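import Summits.RiemannHypothesis.RiemannHypothesis.Theorems.Splittings.RobinFiniteSqrtWindowCells
import HarnessLib

/-!
# RobinFiniteSqrtWindowCover — gen 16 «Q-SCALE √-WINDOW LIFTS THE LEVEL BUDGETS», part 3/5: tail and cover soundness, the lifted budgets `bkS`, the seven kernel certificates (+ tightness), the key inequality

Cell rh-split, seat rh-split-robin-finite g16 (card `cards/SPLIT-robin-finite.md` §23).

THE LEVER (gen 16).  The landed cell certificates (`RobinAnalyticSharp.cover11 … cover17`, budgets `b₁₁ … b₁₇ = 0.105 … 0.50`) price the
SECOND prime `Q` with Schoenfeld's RH-form relative error `δ(Q) = log²Q/(8π√Q)` two-sided.  Büthe 2018 Thm 2 (`Buthe2018_thm2_theta`,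
already a hypothesis of every low-height row) gives the ONE-SIDED `√`-window `y − 1.95√y ≤ θ(y) ≤ y` (`1423 ≤ y ≤ 10¹⁹`):
`δ_l(Q) = 1.95/√Q`, `δ_u = 0`, `δ(P) ↦ 0`.  Re-certifying the SAME covers (`coverOKS`, `decide +kernel`) lifts the budgets to
`b'₁₁ … b'₁₇ = 0.208, 0.332, 0.405, 0.461, 0.504, 0.538, 0.564`; Büthe 2016 and the range condition drop out below `10¹⁹`.
Rows (RH(T) in hypothesis position): `RH(10⁵) ⟹ robinCA_below 55 000 001`; `4¹³ ← RH(124 000)`, `4¹⁴ ← RH(212 000)`,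
`4¹⁵ ← RH(364 000)`, `4¹⁶ ← RH(705 000)`, `4¹⁷ ← RH(1.4·10⁶)`, `4¹⁸ ← RH(2.65·10⁶)` (tree: —, 330 000, 500 000, 860 000, 1.62·10⁶, 3·10⁶).

HONEST LABEL: SPLITTING SEARCH over kernel-typed RH-EQUIVALENCES; a splitting A ∧ B ⟹ RH is CONDITIONAL
bookkeeping unless A and B are both proved; nothing here bears on the truth of RH.

This part (1 `def`, 17 theorems): S4b `tail_soundS`, `cover_keyS`, `bkS`, `coverS11_ok … coverS17_ok` (`decide +kernel`, `= true` at `b'_k`), `coverS11_tight … coverS17_tight`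
(`= false` at `b'_k + 10⁻³`), `key_ineq_levelS` (`Eb b' P < G₂ + G₁` on `4ᵏ ≤ P ≤ 4ᵏ⁺¹`, `b' ≤ b'_k`, from Büthe 2018 Thm 2 ALONE).
-/

set_option linter.dupNamespace false

noncomputable section

open Real Filter Finset
open scoped Chebyshev

namespace Summit.RiemannHypothesis.RiemannHypothesis.Theorems.Splittings.RobinFiniteC1

open Literature.NumberTheory.LFunctions Literature.NumberTheory.DiophantineGeometry
open RobinAnalyticSharp RobinAnalyticSharp.Cells
open Summit.RiemannHypothesis.RiemannHypothesis.Theorems.Splittings.RobinFiniteE3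

section SqrtWindowCover

/-! ### S4b · tail, cover, the lifted budgets, the seven certificates, the key inequality -/

/-- **Soundness of `checkTailS`** (`Q ≥ n√P/2^k`, `n ≥ 1423`: `G₁` alone with `θQ ≥ (1 − 1.95/√Q)Q`, `θP + θQ ≤ 2P`). -/
theorem tail_soundS {B : ℝ} (hW : ∀ y : ℝ, 599 ≤ y → y ≤ B → |θ y - y| ≤ √y * Real.log y ^ 2 / (8 * π))
    (hLo : ∀ y : ℝ, 1423 ≤ y → y ≤ B → y - 1.95 * √y ≤ θ y)
    (hUp : ∀ y : ℝ, 1 ≤ y → y ≤ B → θ y ≤ y)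
    {b : ℚ} (hb0 : (0 : ℝ) ≤ b) (hb2 : (b : ℝ) ≤ 2.042)
    (k : ℕ) (A : Anchor) (p16 : ℚ) (h : checkTailS b k A p16 = true) {P Q : ℕ} (hPl : 4 ^ k ≤ P)
    (hPu : P ≤ 4 ^ (k + 1)) (hPB : (P : ℝ) ≤ B) (hQ : 599 ≤ Q) (hQP : Q ≤ P)
    (hQ₁ : (A.n : ℝ) * √(P : ℝ) ≤ (Q : ℝ) * 2 ^ k) :
    (nicolasERH P + ((b : ℝ) - nicolasBeta) * (1 / (√P * Real.log P) + 1 / (√P * Real.log P ^ 2) + 4 / (√P * Real.log P ^ 3))) <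
      ∑ p ∈ (Nat.primesLE P).filter (fun p => Q < p), ((p : ℝ) ^ 2)⁻¹ +
        θ Q / ((θ P + θ Q) * Real.log (θ P + θ Q)) := by
  simp only [checkTailS, Bool.and_eq_true, decide_eq_true_eq] at h
  obtain ⟨⟨⟨h, hn1423⟩, hdT1⟩, hcellB⟩ := h
  simp only [checkTail, Bool.and_eq_true, decide_eq_true_eq] at h
  obtain ⟨⟨⟨⟨⟨hA, hk⟩, hp0⟩, hp6⟩, -⟩, -⟩ := h
  obtain ⟨hP₁599, hL₁, hU₁, hL₂, hL₁8, hs₁, hs₁0⟩ := range_facts hk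
  have hPl' : (4 : ℝ) ^ k ≤ P := by exact_mod_cast hPl
  have hPu' : (P : ℝ) ≤ (4 : ℝ) ^ (k + 1) := by exact_mod_cast hPu
  have h2k : (0 : ℝ) < 2 ^ k := by positivity
  have hQr : (599 : ℝ) ≤ Q := by exact_mod_cast hQ
  have hQPr : (Q : ℝ) ≤ P := by exact_mod_cast hQP
  have hP599 : (599 : ℝ) ≤ P := hQr.trans hQPr
  have hP0 : (0 : ℝ) < P := by linarith
  have hQ0 : (0 : ℝ) < Q := by linarith
  have hsP : (2 : ℝ) ^ k ≤ √(P : ℝ) := by rw [← sqrt_four_pow]; exact Real.sqrt_le_sqrt hPl'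
  set a : ℝ := (A.n : ℝ) / 2 ^ k with ha_def
  have ha : a * √(P : ℝ) ≤ Q := by
    rw [ha_def, div_mul_eq_mul_div, div_le_iff₀ h2k]; exact hQ₁
  have ha0 : 0 ≤ a := by rw [ha_def]; positivity
  have hnQ : (A.n : ℝ) ≤ Q := by
    have h1 : (A.n : ℝ) * 2 ^ k ≤ (A.n : ℝ) * √(P : ℝ) := mul_le_mul_of_nonneg_left hsP (Nat.cast_nonneg _)
    exact le_of_mul_le_mul_right (h1.trans hQ₁) h2k
  have hn1423r : (1423 : ℝ) ≤ A.n := by exact_mod_cast hn1423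
  have hQ1423 : (1423 : ℝ) ≤ Q := hn1423r.trans hnQ
  -- `θ`-facts
  set L := Real.log (P : ℝ) with hL
  set s := √(P : ℝ) with hs
  have hs0 : 0 < s := Real.sqrt_pos.2 hP0
  have hss : s * s = P := Real.mul_self_sqrt hP0.le
  have hLpos : 0 < L := Real.log_pos (by linarith)
  have hLl : ((L1 k : ℚ) : ℝ) ≤ L := hL₁.trans (Real.log_le_log (by positivity) hPl')
  have hL₁0 : (0 : ℝ) < ((L1 k : ℚ) : ℝ) := by linarith
  have hsL : 0 < s * L := mul_pos hs0 hLpos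
  have hS0 : 0 ≤ ∑ p ∈ (Nat.primesLE P).filter (fun p => Q < p), ((p : ℝ) ^ 2)⁻¹ :=
    Finset.sum_nonneg fun p _ => by positivity
  set δl : ℝ := 1.95 / √(Q : ℝ) with hδl_def
  have hsQ0 : 0 < √(Q : ℝ) := Real.sqrt_pos.2 hQ0
  have hθQl : (1 - δl) * (Q : ℝ) ≤ θ Q := sqrtWindow_lower hLo hQ1423 hPB Q ⟨le_rfl, hQPr⟩
  have hθPu : θ (P : ℝ) ≤ P := hUp P (by linarith) hPB
  have hθQu : θ (Q : ℝ) ≤ Q := hUp Q (by linarith) (hQPr.trans hPB)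
  have hθP1 : 1 ≤ θ (P : ℝ) := one_le_theta_ofW hW hP599 hPB
  obtain ⟨hr, hr0⟩ := A.r_le_sqrt hA
  have hdT : δl ≤ (((dT A) : ℚ) : ℝ) := by
    simp only [dT]; push_cast
    have hrQ : ((A.r : ℚ) : ℝ) ≤ √(Q : ℝ) := hr.trans (Real.sqrt_le_sqrt hnQ)
    rw [hδl_def, div_le_div_iff₀ hsQ0 (by positivity)]
    nlinarith
  have hdT1r : (((dT A) : ℚ) : ℝ) ≤ 1 / 2 := by
    have h := (Rat.cast_le (K := ℝ)).2 hdT1; push_cast at h; exact h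
  have hδl0 : 0 ≤ δl := by positivity
  -- `G₁ ≥ (1 − δl) Q/(R₁ log R₁)`, `R₁ = P + Q ≤ 2P`
  set R₁ := (P : ℝ) + Q with hR₁
  have hlow : 0 ≤ (1 - δl) * Q := mul_nonneg (by linarith) hQ0.le
  have hG := G1_lower hθP1 (Chebyshev.theta_nonneg _) hθQl hlow (by linarith : θ P + θ Q ≤ R₁)
  have hR₁le : R₁ ≤ 2 * P := by simp only [hR₁]; linarith
  have hR₁1 : 1 < R₁ := by simp only [hR₁]; linarith
  have hden0 : 0 < R₁ * Real.log R₁ := mul_pos (by linarith) (Real.log_pos hR₁1)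
  have hlogR : R₁ * Real.log R₁ ≤ (2 * P) * (L + (2 - 1)) := by
    have h1 := mul_log_mono hR₁1.le hR₁le
    have h2 : Real.log (2 * P) ≤ L + (2 - 1) := by
      rw [Real.log_mul (by norm_num) hP0.ne']
      linarith [Real.log_le_sub_one_of_pos (by norm_num : (0 : ℝ) < 2)]
    exact h1.trans (mul_le_mul_of_nonneg_left h2 (by positivity))
  set d : ℝ := (((dT A) : ℚ) : ℝ) with hd_def
  have hnum : (1 - d) * (a * s) ≤ (1 - δl) * Q := mul_le_mul (by linarith) ha (by positivity) (by linarith)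
  have hG2 : (1 - d) * (a * s) / ((2 * P) * (L + (2 - 1))) ≤ (1 - δl) * Q / (R₁ * Real.log R₁) := by
    calc (1 - d) * (a * s) / ((2 * P) * (L + (2 - 1)))
        ≤ (1 - d) * (a * s) / (R₁ * Real.log R₁) :=
          div_le_div_of_nonneg_left (mul_nonneg (by linarith) (by positivity)) hden0 hlogR
      _ ≤ (1 - δl) * Q / (R₁ * Real.log R₁) := div_le_div_of_nonneg_right hnum hden0.le
  have e : (1 - d) * (a * s) / ((2 * P) * (L + (2 - 1))) * (s * L) = (1 - d) * a / (2 * (1 + 1 / L)) := by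
    rw [← hss]; field_simp; ring
  have hbox : (1 - d) * a / (2 * (1 + 1 / ((L1 k : ℚ) : ℝ))) ≤ (1 - d) * a / (2 * (1 + 1 / L)) := by
    apply div_le_div_of_nonneg_left (mul_nonneg (by linarith) ha0) (by positivity)
    apply mul_le_mul_of_nonneg_left _ (by norm_num)
    have : 1 / L ≤ 1 / ((L1 k : ℚ) : ℝ) := div_le_div_of_nonneg_left (by norm_num) hL₁0 hLl
    linarith
  have hG1 : (1 - d) * a / (2 * (1 + 1 / ((L1 k : ℚ) : ℝ))) ≤
      θ Q / ((θ P + θ Q) * Real.log (θ P + θ Q)) * (s * L) := by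
    calc (1 - d) * a / (2 * (1 + 1 / ((L1 k : ℚ) : ℝ))) ≤ (1 - d) * a / (2 * (1 + 1 / L)) := hbox
      _ = (1 - d) * (a * s) / ((2 * P) * (L + (2 - 1))) * (s * L) := e.symm
      _ ≤ (1 - δl) * Q / (R₁ * Real.log R₁) * (s * L) := mul_le_mul_of_nonneg_right hG2 hsL.le
      _ ≤ θ Q / ((θ P + θ Q) * Real.log (θ P + θ Q)) * (s * L) := mul_le_mul_of_nonneg_right hG hsL.le
  have hcell' : ((eBoxEbQ b k p16 : ℚ) : ℝ) < (1 - d) * a / (2 * (1 + 1 / ((L1 k : ℚ) : ℝ))) := by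
    rw [ha_def, hd_def]
    have h := (Rat.cast_lt (K := ℝ)).2 hcellB
    push_cast at h
    exact h
  have hE := Eb_mul_le_levelBox hk hb0 hb2 hp0 hp6 hPl' hPu'
  have h : (nicolasERH P + ((b : ℝ) - nicolasBeta) * (1 / (√P * Real.log P) + 1 / (√P * Real.log P ^ 2) +
      4 / (√P * Real.log P ^ 3))) * (s * L) <
      (∑ p ∈ (Nat.primesLE P).filter (fun p => Q < p), ((p : ℝ) ^ 2)⁻¹ +
        θ Q / ((θ P + θ Q) * Real.log (θ P + θ Q))) * (s * L) := by
    rw [add_mul]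
    have : 0 ≤ (∑ p ∈ (Nat.primesLE P).filter (fun p => Q < p), ((p : ℝ) ^ 2)⁻¹) * (s * L) :=
      mul_nonneg hS0 hsL.le
    linarith
  exact lt_of_mul_lt_mul_right h hsL.le

/-- **`Eb b P < G₂ + G₁` on a `√`-window-certified level** `coverOKS b k l T p16 = true` (shape of `cover_keyB`). -/
theorem cover_keyS {B : ℝ} (hW : ∀ y : ℝ, 599 ≤ y → y ≤ B → |θ y - y| ≤ √y * Real.log y ^ 2 / (8 * π))
    (hLo : ∀ y : ℝ, 1423 ≤ y → y ≤ B → y - 1.95 * √y ≤ θ y)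
    (hUp : ∀ y : ℝ, 1 ≤ y → y ≤ B → θ y ≤ y)
    {b : ℚ} (hb0 : (0 : ℝ) ≤ b) (hb2 : (b : ℝ) ≤ 2.042) {k : ℕ} {l : List Cell}
    {T : Anchor} {p16 : ℚ} (h : coverOKS b k l T p16 = true) {P Q : ℕ} (hPl : 4 ^ k ≤ P)
    (hPu : P ≤ 4 ^ (k + 1)) (hPB : (P : ℝ) ≤ B) (hQP : Q ≤ P) :
    (nicolasERH P + ((b : ℝ) - nicolasBeta) * (1 / (√P * Real.log P) + 1 / (√P * Real.log P ^ 2) + 4 / (√P * Real.log P ^ 3))) <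
      ∑ p ∈ (Nat.primesLE P).filter (fun p => Q < p), ((p : ℝ) ^ 2)⁻¹ +
        θ Q / ((θ P + θ Q) * Real.log (θ P + θ Q)) := by
  match l, h with
  | c₀ :: t, h =>
    simp only [coverOKS, Bool.and_eq_true, decide_eq_true_eq, beq_iff_eq, List.all_eq_true] at h
    obtain ⟨⟨⟨⟨⟨⟨hfirst, h599⟩, hT1423⟩, hall⟩, hchain⟩, hlast⟩, htail⟩ := h
    have hk0 : c₀.k = k := (hall c₀ (by simp)).2
    have hPl' : (4 : ℝ) ^ k ≤ P := by exact_mod_cast hPl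
    have hP0 : (0 : ℝ) < P := lt_of_lt_of_le (by positivity) hPl'
    have hsP : 0 < √(P : ℝ) := Real.sqrt_pos.2 hP0
    have h2k : (0 : ℝ) < 2 ^ k := by positivity
    rcases le_or_gt Q 599 with hQ | hQ
    · exact cell_soundFirstS hW hUp hb0 hb2 c₀ hfirst h599 (hk0 ▸ hPl) (hk0 ▸ hPu) hPB hQ
    · have hQ' : 599 ≤ Q := hQ.le
      set x : ℝ := (Q : ℝ) * 2 ^ k / √(P : ℝ) with hx
      rcases le_or_gt (T.n : ℝ) x with hT | hT
      · refine tail_soundS hW hLo hUp hb0 hb2 k T p16 htail hPl hPu hPB hQ' hQP ?_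
        rwa [hx, le_div_iff₀ hsP] at hT
      · have hzero : c₀.A₁.n = 0 := by
          simp only [cellCheckFirstS, Cell.checkFirst, Bool.and_eq_true, beq_iff_eq,
            decide_eq_true_eq] at hfirst
          exact hfirst.1.1.2
        have hx0 : (c₀.A₁.n : ℝ) ≤ x := by rw [hzero, Nat.cast_zero]; positivity
        have hxl : x ≤ lastN (c₀ :: t) := by rw [hlast]; exact hT.le
        obtain ⟨c, hc, hc1, hc2⟩ := exists_bracket t c₀ hchain x hx0 hxl
        obtain ⟨hcc, hck⟩ := hall c hc
        refine cell_soundS hW hLo hUp hb0 hb2 c hcc (hck ▸ hPl) (hck ▸ hPu) hPB hQ' hQP ?_ ?_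
        · rw [hck]; rwa [hx, le_div_iff₀ hsP] at hc1
        · rw [hck]; rwa [hx, div_le_iff₀ hsP] at hc2

/-- The LIFTED per-level budgets `b'₁₁ … b'₁₇` (exact rational margins of the landed covers against the `√`-window boxes:
`0.20873, 0.33224, 0.40547, 0.46164, 0.50485, 0.53826, 0.56428`; the tree's `bk`: `0.105, 0.22, 0.30, 0.37, 0.42, 0.47, 0.50`). -/
def bkS : ℕ → ℚ
  | 11 => 208 / 1000 | 12 => 332 / 1000 | 13 => 405 / 1000 | 14 => 461 / 1000 | 15 => 504 / 1000
  | 16 => 538 / 1000 | 17 => 564 / 1000 | _ => 0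

/-- Level 11 passes at budget `0.208` against the `√`-window (kernel evaluation; cell data of `RobinAnalyticSharp.lean`). -/
theorem coverS11_ok : coverOKS (bkS 11) 11 cover11 tail11 p16_11 = true := by decide +kernel
/-- Level 12 passes at budget `0.332`. -/
theorem coverS12_ok : coverOKS (bkS 12) 12 cover12 tail12 p16_12 = true := by decide +kernel
/-- Level 13 passes at budget `0.405`. -/
theorem coverS13_ok : coverOKS (bkS 13) 13 cover13 tail13 p16_13 = true := by decide +kernel
/-- Level 14 passes at budget `0.461`. -/
theorem coverS14_ok : coverOKS (bkS 14) 14 cover14 tail14 p16_14 = true := by decide +kernel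
/-- Level 15 passes at budget `0.504`. -/
theorem coverS15_ok : coverOKS (bkS 15) 15 cover15 tail15 p16_15 = true := by decide +kernel
/-- Level 16 passes at budget `0.538`. -/
theorem coverS16_ok : coverOKS (bkS 16) 16 cover16 tail16 p16_16 = true := by decide +kernel
/-- Level 17 passes at budget `0.564`. -/
theorem coverS17_ok : coverOKS (bkS 17) 17 cover17 tail17 p16_17 = true := by decide +kernel

/-! The lifted budgets are TIGHT to `10⁻³` for these covers: one notch up, the same kernel evaluation returns `false`
(built-in mutation control; a finer cover near `Q ≈ 2P/3` would lift them further — not attempted here). -/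

/-- Level 11 is REJECTED at budget `0.209`. -/
theorem coverS11_tight : coverOKS (bkS 11 + 1 / 1000) 11 cover11 tail11 p16_11 = false := by decide +kernel
/-- Level 12 is rejected at budget `0.333`. -/
theorem coverS12_tight : coverOKS (bkS 12 + 1 / 1000) 12 cover12 tail12 p16_12 = false := by decide +kernel
/-- Level 13 is rejected at budget `0.406`. -/
theorem coverS13_tight : coverOKS (bkS 13 + 1 / 1000) 13 cover13 tail13 p16_13 = false := by decide +kernel
/-- Level 14 is rejected at budget `0.462`. -/
theorem coverS14_tight : coverOKS (bkS 14 + 1 / 1000) 14 cover14 tail14 p16_14 = false := by decide +kernel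
/-- Level 15 is rejected at budget `0.505`. -/
theorem coverS15_tight : coverOKS (bkS 15 + 1 / 1000) 15 cover15 tail15 p16_15 = false := by decide +kernel
/-- Level 16 is rejected at budget `0.539`. -/
theorem coverS16_tight : coverOKS (bkS 16 + 1 / 1000) 16 cover16 tail16 p16_16 = false := by decide +kernel
/-- Level 17 is rejected at budget `0.565`. -/
theorem coverS17_tight : coverOKS (bkS 17 + 1 / 1000) 17 cover17 tail17 p16_17 = false := by decide +kernel

/-- **Key inequality on a level `11 ≤ k ≤ 17` at any budget `b' ≤ b'_k`, from Büthe 2018 Thm 2 alone**: `Eb b' P < G₂ + G₁` for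
`4ᵏ ≤ P ≤ 4ᵏ⁺¹`, `Q ≤ P` (windows `thetaWindow_ofB`, `thetaLower_ofB`, `thetaUpper_ofB` on `[·, 10¹⁹] ⊇ [·, 4¹⁸]`). -/
theorem key_ineq_levelS (hB : Buthe2018_thm2_theta)
    {k : ℕ} (hk11 : 11 ≤ k) (hk17 : k ≤ 17) {P Q : ℕ} (hPl : 4 ^ k ≤ P) (hPu : P ≤ 4 ^ (k + 1))
    (hQP : Q ≤ P) {b' : ℝ} (hb' : b' ≤ ((bkS k : ℚ) : ℝ)) :
    (nicolasERH P + (b' - nicolasBeta) * (1 / (√P * Real.log P) + 1 / (√P * Real.log P ^ 2) + 4 / (√P * Real.log P ^ 3))) <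
      ∑ p ∈ (Nat.primesLE P).filter (fun p => Q < p), ((p : ℝ) ^ 2)⁻¹ +
        θ Q / ((θ P + θ Q) * Real.log (θ P + θ Q)) := by
  have hW := thetaWindow_ofB hB
  have hLo := thetaLower_ofB hB
  have hUp := thetaUpper_ofB hB
  have hPr : (4 : ℝ) ^ k ≤ P := by exact_mod_cast hPl
  have hP1 : (1 : ℝ) < P := lt_of_lt_of_le (by norm_num) (le_trans (pow_le_pow_right₀ (by norm_num) hk11) hPr)
  have hPB : (P : ℝ) ≤ (10 : ℝ) ^ 19 := by
    have h1 : (P : ℝ) ≤ (4 : ℝ) ^ (k + 1) := by exact_mod_cast hPu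
    exact h1.trans ((pow_le_pow_right₀ (by norm_num) (by omega : k + 1 ≤ 18)).trans (by norm_num))
  refine lt_of_le_of_lt (Eb_mono hP1 hb') ?_
  interval_cases k
  · exact cover_keyS hW hLo hUp (by norm_num [bkS]) (by norm_num [bkS]) coverS11_ok hPl hPu hPB hQP
  · exact cover_keyS hW hLo hUp (by norm_num [bkS]) (by norm_num [bkS]) coverS12_ok hPl hPu hPB hQP
  · exact cover_keyS hW hLo hUp (by norm_num [bkS]) (by norm_num [bkS]) coverS13_ok hPl hPu hPB hQP
  · exact cover_keyS hW hLo hUp (by norm_num [bkS]) (by norm_num [bkS]) coverS14_ok hPl hPu hPB hQP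
  · exact cover_keyS hW hLo hUp (by norm_num [bkS]) (by norm_num [bkS]) coverS15_ok hPl hPu hPB hQP
  · exact cover_keyS hW hLo hUp (by norm_num [bkS]) (by norm_num [bkS]) coverS16_ok hPl hPu hPB hQP
  · exact cover_keyS hW hLo hUp (by norm_num [bkS]) (by norm_num [bkS]) coverS17_ok hPl hPu hPB hQP

end SqrtWindowCover

end Summit.RiemannHypothesis.RiemannHypothesis.Theorems.Splittings.RobinFiniteC1

/-! ### Standard-axiom guards (RH(T) in hypothesis position; no kernel certificate is imported by this file) -/

/-- info: 'Summit.RiemannHypothesis.RiemannHypothesis.Theorems.Splittings.RobinFiniteC1.key_ineq_levelS' depends on axioms: [propext, Classical.choice, Quot.sound] -/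
#guard_msgs (whitespace := lax) in
#print axioms Summit.RiemannHypothesis.RiemannHypothesis.Theorems.Splittings.RobinFiniteC1.key_ineq_levelS

end
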